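import Mathlib
import HarnessLib
import Summits.Ventures.LatticeQCDFlow.Exactness.NCMCGeneralSpaceReplicaPooledCLT
import Summits.Ventures.LatticeQCDFlow.Exactness.NCMCGeneralSpaceRestartChainCLT
import Summits.Ventures.LatticeQCDFlow.Exactness.NCMCGeneralSpaceAsymptoticVarianceLowerBound

/-!
# The Jarzynski lane over `R` INDEPENDENT streams of correlated launches, POOLED: `√(R n) (ΔF̂_{R,n} − ΔF) ⇒ N(0, σ²_w e^{2ΔF})` from EVERY family of launch configurations, for bounded-below work

HONEST FRAMING: exact (Metropolis-corrected) sampling algorithms for lattice gauge theory;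
figures of merit are autocorrelation/cost numbers at stated couplings and volumes; no
continuum-physics claim.

Venture `LatticeQCDFlow` (cell pub-lqcd), topic `Exactness`; FANOUT row 13 (`eng-snf`, GEN-23).
NEW WORK of the cell, not a published result; no definition is introduced; nothing is cited as a
fact.  GEN-22 (`NCMCGeneralSpaceRestartChainCLT`) typed the engine's default lane along ONE stream of
correlated launches: the records `ω_0, ω_1, …` launched off one equilibrium stream with the level
sampler `K` between launches form the restart chain `R = (κF ∘ₖ K).comap s`, minorised in one step,
and `√n (ΔF̂_n − ΔF) ⇒ N(0, σ²_w/(Z₁/Z₀)²)` from every initial record law for bounded-below work.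
The engine's `replicas` option runs `R` such streams from their own launch configurations with
independent seeds and reports the POOLED estimate
`ΔF̂_{R,n} = −log Ȳ_{R,n}`, `Ȳ_{R,n} = (Σ_r Σ_{i<n} e^{−W(ω^r_i)})/(R n)`.  GEN-23's pooled chain CLT
(`tendstoInDistribution_sqrt_mul_pooledMean_sub_of_nHit`, `NCMCGeneralSpaceReplicaPooledCLT`) applied
to the restart chain gives `√(R n) (Ȳ_{R,n} − Z₁/Z₀) ⇒ N(0, σ²_w)` under the product of the `R`
chain laws; the pooled strong law and the difference quotient of `log` (`dslope`, Slutsky) turn it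
into the CLT of `ΔF̂_{R,n}` — with the ONE-stream Green–Kubo variance `σ²_w` at the pooled sample size.

## Content (Crooks pair between finite weights, `Z₀ ≠ 0`; `K` Markov, `ν₀`-invariant, `m ≤ K(z, ·)`
## for all `z`, `m` finite non-zero; `R = (κF ∘ₖ K).comap s`; `P_F = fwdPathLaw ν₀ κF`; `ι` finite
## non-empty, `R = card ι`; `μ : ι → Measure E` ANY initial record laws; the replica law is the product
## `⊗_r P_{μ r}` of row 8's chain laws of `R`)

* **`CrooksPair.tendstoInDistribution_pooledSum_restartChains`** — EVERY bounded measurable record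
  observable `g`: `(√(R n))⁻¹ Σ_r Σ_{i<n} (g(ω^r_i) − E_F g) ⇒ N(0, σ²_g)`.
* **`CrooksPair.tendstoInDistribution_sqrt_mul_pooledMeanWeight_sub_restartChains`** — `−B ≤ W`:
  `√(R n) (Ȳ_{R,n} − Z₁/Z₀) ⇒ N(0, σ²_w)`;
  **`CrooksPair.tendsto_pooledMeanWeight_ae_restartChains`** — `Ȳ_{R,n} → Z₁/Z₀` almost surely;
  **`CrooksPair.tendsto_pooledKishESS_ae_restartChains`** — the POOLED Kish fraction
  `(Σ_r Σ_i e^{−W})²/((R n) Σ_r Σ_i e^{−2W}) → (Z₁/Z₀)²/E_F e^{−2W} = ESS_F` almost surely.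
* **`CrooksPair.tendstoInDistribution_sqrt_mul_pooledJarzynski_sub_restartChains`** — `−B ≤ W`,
  `e^{−ΔF} = Z₁/Z₀`: `√(R n) (ΔF̂_{R,n} − ΔF) ⇒ N(0, σ²_w/(Z₁/Z₀)²)` from EVERY family of initial
  record laws; **`…_everyStart`** — the engine's form, replica `r` first launched from ANY
  configuration `x r` (`μ r = κF (x r)`).

Reading (value-free): `R` independent streams of `n` correlated launches each carry, to leading
order, the error bar `√(σ²_w e^{2ΔF}/(R n))` of ONE stream of `R n` launches.  NOT CLAIMED: dependent
streams; unequal stream lengths; unbounded work; `σ²_w > 0` (GEN-22's variance floor / start-observable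
files give sufficient conditions); the exactness of the printed pooled error bar (see
`NCMCGeneralSpaceReplicaPooledJarzynskiCoverage`); anything numerical.
-/

namespace Summit.Ventures.LatticeQCDFlow.Exactness.GeneralNCMC

open MeasureTheory ProbabilityTheory Set Filter Finset
open scoped ENNReal NNReal Topology

variable {Ω E : Type*} [MeasurableSpace Ω] [MeasurableSpace E]

namespace CrooksPair

variable {ν₀ ν₁ : Measure Ω} [IsFiniteMeasure ν₀] [IsFiniteMeasure ν₁] {κF κR : Kernel Ω E}
  [IsMarkovKernel κF] [IsMarkovKernel κR] {s e : E → Ω} {W : E → ℝ}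
  {ι : Type*} [Fintype ι] [Nonempty ι]

/-! ## §1 Bounded record observables pooled over independent restart chains -/

omit [IsFiniteMeasure ν₁] [IsMarkovKernel κR] in
/-- **THE POOLED CLT ALONG `R` INDEPENDENT RESTART CHAINS, ANY BOUNDED RECORD OBSERVABLE, ANY INITIAL
RECORD LAWS.**  Crooks pair with `Z₀ ≠ 0`; `K` Markov, `ν₀`-invariant, `m ≤ K(z, ·)` for all `z`
(`m` finite, `m(Ω) ≠ 0`); `g` measurable with `|g| ≤ C`; `μ r` ANY initial record laws.  For every
real random variable `Y` with law `N(0, σ²_g)`, `σ²_g = C_ḡ(0) + 2 Σ_{t≥1} C_ḡ(t)` along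
`R = (κF ∘ₖ K).comap s` under `P_F`:
`(√(R n))⁻¹ Σ_r Σ_{i<n} (g(ω^r_i) − ∫ g dP_F) ⇒ Y` under the product of the chain laws. -/
theorem tendstoInDistribution_pooledSum_restartChains (K : Kernel Ω Ω) [IsMarkovKernel K]
    (h0 : ν₀ univ ≠ 0) (hK : Kernel.Invariant K ν₀) (h : CrooksPair ν₀ ν₁ κF κR s e W)
    {m : Measure Ω} [IsFiniteMeasure m] (hm0 : m univ ≠ 0) (hmin : ∀ z, m ≤ K z)
    {g : E → ℝ} (hg : Measurable g) {C : ℝ} (hC : ∀ ω, |g ω| ≤ C)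
    (μ : ι → Measure E) [∀ r, IsProbabilityMeasure (μ r)]
    {Ω' : Type*} [MeasurableSpace Ω'] {P' : Measure Ω'} [IsProbabilityMeasure P'] {Y : Ω' → ℝ}
    (hY : HasLaw Y (gaussianReal 0 (Real.toNNReal
      (Scoring.autocov ((κF ∘ₖ K).comap s h.measurable_s) (fwdPathLaw ν₀ κF)
          (fun ω => g ω - ∫ z, g z ∂(fwdPathLaw ν₀ κF)) 0
        + 2 * ∑' t, Scoring.autocov ((κF ∘ₖ K).comap s h.measurable_s) (fwdPathLaw ν₀ κF)
          (fun ω => g ω - ∫ z, g z ∂(fwdPathLaw ν₀ κF)) (t + 1)))) P')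
    [∀ r, IsProbabilityMeasure (Kernel.trajMeasure (X := fun _ : ℕ => E) (μ r)
        (fun n : ℕ => ((κF ∘ₖ K).comap s h.measurable_s).comap
          (fun hh : (j : ↥(Finset.Iic n)) → E => hh ⟨n, Finset.mem_Iic.2 le_rfl⟩)
          (measurable_pi_apply _)))] :
    TendstoInDistribution (fun (n : ℕ) (ω : ι → ℕ → E) =>
        (Real.sqrt ((Fintype.card ι : ℝ) * n))⁻¹
          * ∑ r, ∑ i ∈ range n, (g (ω r i) - ∫ z, g z ∂(fwdPathLaw ν₀ κF)))
      atTop Y (fun _ => Measure.pi fun r => Kernel.trajMeasure (X := fun _ : ℕ => E) (μ r)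
        (fun n : ℕ => ((κF ∘ₖ K).comap s h.measurable_s).comap
          (fun hh : (j : ↥(Finset.Iic n)) → E => hh ⟨n, Finset.mem_Iic.2 le_rfl⟩)
          (measurable_pi_apply _))) P' := by
  haveI := isProbabilityMeasure_fwdPathLaw ν₀ h0 κF
  haveI := isProbabilityMeasure_normalised_bind_kernel κF hm0
  exact tendstoInDistribution_pooledSum_of_nHit (h.invariant_restartKernel K hK) hm0
    (restartKernel_nHit_one_minorised K h hm0 hmin) Nat.one_pos hg hC μ hY

/-! ## §2 The pooled mean weight -/

omit [IsFiniteMeasure ν₁] in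
/-- **`√(R n) (Ȳ_{R,n} − Z₁/Z₀) ⇒ N(0, σ²_w)` FROM EVERY FAMILY OF INITIAL RECORD LAWS**, `−B ≤ W`,
`Ȳ_{R,n} = (Σ_r Σ_{i<n} e^{−W(ω^r_i)})/(R n)`, `σ²_w = C_w̄(0) + 2 Σ_{t≥1} C_w̄(t)`, `w̄ = e^{−W} − Z₁/Z₀`. -/
theorem tendstoInDistribution_sqrt_mul_pooledMeanWeight_sub_restartChains (K : Kernel Ω Ω)
    [IsMarkovKernel K] (h0 : ν₀ univ ≠ 0) (hK : Kernel.Invariant K ν₀)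
    (h : CrooksPair ν₀ ν₁ κF κR s e W) {m : Measure Ω} [IsFiniteMeasure m] (hm0 : m univ ≠ 0)
    (hmin : ∀ z, m ≤ K z) {B : ℝ} (hB : ∀ ω, -B ≤ W ω)
    (μ : ι → Measure E) [∀ r, IsProbabilityMeasure (μ r)]
    {Ω' : Type*} [MeasurableSpace Ω'] {P' : Measure Ω'} [IsProbabilityMeasure P'] {Y : Ω' → ℝ}
    (hY : HasLaw Y (gaussianReal 0 (Real.toNNReal
      (Scoring.autocov ((κF ∘ₖ K).comap s h.measurable_s) (fwdPathLaw ν₀ κF)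
          (fun ω => Real.exp (-W ω) - ((ν₀ univ)⁻¹ * ν₁ univ).toReal) 0
        + 2 * ∑' t, Scoring.autocov ((κF ∘ₖ K).comap s h.measurable_s) (fwdPathLaw ν₀ κF)
          (fun ω => Real.exp (-W ω) - ((ν₀ univ)⁻¹ * ν₁ univ).toReal) (t + 1)))) P')
    [∀ r, IsProbabilityMeasure (Kernel.trajMeasure (X := fun _ : ℕ => E) (μ r)
        (fun n : ℕ => ((κF ∘ₖ K).comap s h.measurable_s).comap
          (fun hh : (j : ↥(Finset.Iic n)) → E => hh ⟨n, Finset.mem_Iic.2 le_rfl⟩)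
          (measurable_pi_apply _)))] :
    TendstoInDistribution (fun (n : ℕ) (ω : ι → ℕ → E) =>
        Real.sqrt ((Fintype.card ι : ℝ) * n)
          * ((∑ r, ∑ i ∈ range n, Real.exp (-W (ω r i))) / ((Fintype.card ι : ℝ) * n)
            - ((ν₀ univ)⁻¹ * ν₁ univ).toReal))
      atTop Y (fun _ => Measure.pi fun r => Kernel.trajMeasure (X := fun _ : ℕ => E) (μ r)
        (fun n : ℕ => ((κF ∘ₖ K).comap s h.measurable_s).comap
          (fun hh : (j : ↥(Finset.Iic n)) → E => hh ⟨n, Finset.mem_Iic.2 le_rfl⟩)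
          (measurable_pi_apply _))) P' := by
  haveI := isProbabilityMeasure_fwdPathLaw ν₀ h0 κF
  haveI := isProbabilityMeasure_normalised_bind_kernel κF hm0
  have hθ : ∫ z, Real.exp (-W z) ∂(fwdPathLaw ν₀ κF) = ((ν₀ univ)⁻¹ * ν₁ univ).toReal :=
    h.integral_exp_neg_work
  have hC : ∀ ω, |Real.exp (-W ω)| ≤ Real.exp B := fun ω => by
    rw [abs_of_pos (Real.exp_pos _)]
    exact Real.exp_le_exp.2 (by linarith [hB ω])
  have hclt := tendstoInDistribution_sqrt_mul_pooledMean_sub_of_nHit (h.invariant_restartKernel K hK)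
    hm0 (restartKernel_nHit_one_minorised K h hm0 hmin) Nat.one_pos
    (f := fun ε => Real.exp (-W ε)) (Real.measurable_exp.comp h.measurable_W.neg) hC μ
    (P' := P') (Y := Y) (by rw [hθ]; exact hY)
  rw [hθ] at hclt
  exact hclt

/-- **`Ȳ_{R,n} → Z₁/Z₀` ALMOST SURELY, EVERY FAMILY OF INITIAL RECORD LAWS.** -/
theorem tendsto_pooledMeanWeight_ae_restartChains (K : Kernel Ω Ω) [IsMarkovKernel K]
    (h0 : ν₀ univ ≠ 0) (hK : Kernel.Invariant K ν₀) (h : CrooksPair ν₀ ν₁ κF κR s e W)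
    {m : Measure Ω} [IsFiniteMeasure m] (hm0 : m univ ≠ 0) (hmin : ∀ z, m ≤ K z)
    (μ : ι → Measure E) [∀ r, IsProbabilityMeasure (μ r)]
    [∀ r, IsProbabilityMeasure (Kernel.trajMeasure (X := fun _ : ℕ => E) (μ r)
        (fun n : ℕ => ((κF ∘ₖ K).comap s h.measurable_s).comap
          (fun hh : (j : ↥(Finset.Iic n)) → E => hh ⟨n, Finset.mem_Iic.2 le_rfl⟩)
          (measurable_pi_apply _)))] :
    ∀ᵐ ω ∂(Measure.pi fun r => Kernel.trajMeasure (X := fun _ : ℕ => E) (μ r)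
        (fun n : ℕ => ((κF ∘ₖ K).comap s h.measurable_s).comap
          (fun hh : (j : ↥(Finset.Iic n)) → E => hh ⟨n, Finset.mem_Iic.2 le_rfl⟩)
          (measurable_pi_apply _))),
      Tendsto (fun n : ℕ => (∑ r, ∑ i ∈ range n, Real.exp (-W (ω r i))) / ((Fintype.card ι : ℝ) * n))
        atTop (𝓝 ((ν₀ univ)⁻¹ * ν₁ univ).toReal) := by
  haveI := isProbabilityMeasure_fwdPathLaw ν₀ h0 κF
  haveI := isProbabilityMeasure_normalised_bind_kernel κF hm0
  have key := tendsto_pooledMean_ae_of_nHit_minorised (h.invariant_restartKernel K hK) hm0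
    (restartKernel_nHit_one_minorised K h hm0 hmin) (φ := fun ε => Real.exp (-W ε))
    (Real.measurable_exp.comp h.measurable_W.neg) (h.integrable_exp_neg_work h0) μ
  rw [h.integral_exp_neg_work] at key
  exact key

/-- **THE POOLED KISH FRACTION IS CONSISTENT, EVERY FAMILY OF INITIAL RECORD LAWS** (`−B ≤ W`):
`(Σ_r Σ_{i<n} e^{−W(ω^r_i)})² / ((R n) Σ_r Σ_{i<n} e^{−2W(ω^r_i)}) → (Z₁/Z₀)² / E_F e^{−2W}` (the population
Kish effective sample size fraction `ESS_F` of GEN-12) almost surely under the product of the chain laws. -/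
theorem tendsto_pooledKishESS_ae_restartChains (K : Kernel Ω Ω) [IsMarkovKernel K]
    (h0 : ν₀ univ ≠ 0) (hK : Kernel.Invariant K ν₀) (h : CrooksPair ν₀ ν₁ κF κR s e W)
    {m : Measure Ω} [IsFiniteMeasure m] (hm0 : m univ ≠ 0) (hmin : ∀ z, m ≤ K z)
    {B : ℝ} (hB : ∀ ω, -B ≤ W ω) {ΔF : ℝ} (hΔF : Real.exp (-ΔF) = ((ν₀ univ)⁻¹ * ν₁ univ).toReal)
    (μ : ι → Measure E) [∀ r, IsProbabilityMeasure (μ r)]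
    [∀ r, IsProbabilityMeasure (Kernel.trajMeasure (X := fun _ : ℕ => E) (μ r)
        (fun n : ℕ => ((κF ∘ₖ K).comap s h.measurable_s).comap
          (fun hh : (j : ↥(Finset.Iic n)) → E => hh ⟨n, Finset.mem_Iic.2 le_rfl⟩)
          (measurable_pi_apply _)))] :
    ∀ᵐ ω ∂(Measure.pi fun r => Kernel.trajMeasure (X := fun _ : ℕ => E) (μ r)
        (fun n : ℕ => ((κF ∘ₖ K).comap s h.measurable_s).comap
          (fun hh : (j : ↥(Finset.Iic n)) → E => hh ⟨n, Finset.mem_Iic.2 le_rfl⟩)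
          (measurable_pi_apply _))),
      Tendsto (fun n : ℕ => (∑ r, ∑ i ∈ range n, Real.exp (-W (ω r i))) ^ 2
          / (((Fintype.card ι : ℝ) * n) * ∑ r, ∑ i ∈ range n, Real.exp (-W (ω r i)) ^ 2))
        atTop (𝓝 (((ν₀ univ)⁻¹ * ν₁ univ).toReal ^ 2
          / ∫ ω, Real.exp (-W ω) ^ 2 ∂(fwdPathLaw ν₀ κF))) := by
  haveI := isProbabilityMeasure_fwdPathLaw ν₀ h0 κF
  haveI := isProbabilityMeasure_normalised_bind_kernel κF hm0
  set θ : ℝ := ((ν₀ univ)⁻¹ * ν₁ univ).toReal with hθdef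
  have hθ : 0 < θ := by rw [← hΔF]; exact Real.exp_pos _
  have hwm : Measurable fun ε => Real.exp (-W ε) := Real.measurable_exp.comp h.measurable_W.neg
  have hC : ∀ ω, |Real.exp (-W ω)| ≤ Real.exp B := fun ω => by
    rw [abs_of_pos (Real.exp_pos _)]
    exact Real.exp_le_exp.2 (by linarith [hB ω])
  have hC2 : ∀ ω, |Real.exp (-W ω) ^ 2| ≤ Real.exp B ^ 2 := fun ω => by
    rw [abs_pow]; exact pow_le_pow_left₀ (abs_nonneg _) (hC ω) 2
  -- the second moment is at least `θ² > 0`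
  have hS : θ ^ 2 ≤ ∫ ω, Real.exp (-W ω) ^ 2 ∂(fwdPathLaw ν₀ κF) := by
    rw [hθdef, ← h.integral_exp_neg_work]
    exact sq_integral_le_integral_sq (fwdPathLaw ν₀ κF) hwm hC
  have hSpos : 0 < ∫ ω, Real.exp (-W ω) ^ 2 ∂(fwdPathLaw ν₀ κF) := lt_of_lt_of_le (by positivity) hS
  -- both pooled means converge almost surely
  have hA := h.tendsto_pooledMeanWeight_ae_restartChains K h0 hK hm0 hmin μ
  have hB2 := tendsto_pooledMean_ae_of_nHit_minorised (h.invariant_restartKernel K hK) hm0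
    (restartKernel_nHit_one_minorised K h hm0 hmin) (φ := fun ε => Real.exp (-W ε) ^ 2)
    (hwm.pow_const 2) (Scoring.integrable_of_bounded _ (hwm.pow_const 2) hC2) μ
  filter_upwards [hA, hB2] with ω hωA hωB
  have hlim : Tendsto (fun n : ℕ => ((∑ r, ∑ i ∈ range n, Real.exp (-W (ω r i)))
        / ((Fintype.card ι : ℝ) * n)) ^ 2
      / ((∑ r, ∑ i ∈ range n, Real.exp (-W (ω r i)) ^ 2) / ((Fintype.card ι : ℝ) * n))) atTop
      (𝓝 (θ ^ 2 / ∫ ω, Real.exp (-W ω) ^ 2 ∂(fwdPathLaw ν₀ κF))) := (hωA.pow 2).div hωB hSpos.ne'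
  refine hlim.congr fun n => ?_
  -- `(A_n)²/B_n = (ΣΣ w)² / ((R n) ΣΣ w²)` on every path
  show ((∑ r, ∑ i ∈ range n, Real.exp (-W (ω r i))) / ((Fintype.card ι : ℝ) * n)) ^ 2
      / ((∑ r, ∑ i ∈ range n, Real.exp (-W (ω r i)) ^ 2) / ((Fintype.card ι : ℝ) * n))
    = (∑ r, ∑ i ∈ range n, Real.exp (-W (ω r i))) ^ 2
      / (((Fintype.card ι : ℝ) * n) * ∑ r, ∑ i ∈ range n, Real.exp (-W (ω r i)) ^ 2)
  rcases Nat.eq_zero_or_pos n with hn | hn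
  · subst hn; simp
  · have hR : (0 : ℝ) < Fintype.card ι := by exact_mod_cast Fintype.card_pos
    have hRn : (0 : ℝ) < (Fintype.card ι : ℝ) * n := by positivity
    have hT : 0 < ∑ r, ∑ i ∈ range n, Real.exp (-W (ω r i)) ^ 2 :=
      Finset.sum_pos (fun r _ => Finset.sum_pos (fun i _ => pow_pos (Real.exp_pos _) 2)
        (Finset.nonempty_range_iff.2 hn.ne')) Finset.univ_nonempty
    set Sw := ∑ r, ∑ i ∈ range n, Real.exp (-W (ω r i)) with hSw
    set Tw := ∑ r, ∑ i ∈ range n, Real.exp (-W (ω r i)) ^ 2 with hTw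
    set M := (Fintype.card ι : ℝ) * n with hM
    have hM0 : M ≠ 0 := hRn.ne'
    have hT0 : Tw ≠ 0 := hT.ne'
    rw [div_pow, div_div_eq_mul_div, sq M, ← mul_assoc]
    field_simp
    rw [hM]
    ring

/-! ## §3 The pooled free-energy estimate `ΔF̂_{R,n} = −log Ȳ_{R,n}` -/

/-- **THE CLT FOR THE POOLED JARZYNSKI ESTIMATE, FROM EVERY FAMILY OF INITIAL RECORD LAWS.**  Crooks
pair with `Z₀ ≠ 0` and `e^{−ΔF} = Z₁/Z₀`; bounded-below work `−B ≤ W`; `K` Markov, `ν₀`-invariant,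
dominating a non-zero finite measure `m` from every configuration; `R = card ι ≥ 1` independent
streams started from ANY record laws `μ r`.  For every real random variable `Y` with law
`N(0, σ²_w / (Z₁/Z₀)²)`:
`√(R n) (−log ((Σ_r Σ_{i<n} e^{−W(ω^r_i)})/(R n)) − ΔF) ⇒ Y` under the product of the chain laws. -/
theorem tendstoInDistribution_sqrt_mul_pooledJarzynski_sub_restartChains (K : Kernel Ω Ω)
    [IsMarkovKernel K] (h0 : ν₀ univ ≠ 0) (hK : Kernel.Invariant K ν₀)
    (h : CrooksPair ν₀ ν₁ κF κR s e W) {ΔF : ℝ}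
    (hΔF : Real.exp (-ΔF) = ((ν₀ univ)⁻¹ * ν₁ univ).toReal) {m : Measure Ω} [IsFiniteMeasure m]
    (hm0 : m univ ≠ 0) (hmin : ∀ z, m ≤ K z) {B : ℝ} (hB : ∀ ω, -B ≤ W ω)
    (μ : ι → Measure E) [∀ r, IsProbabilityMeasure (μ r)]
    {Ω' : Type*} [MeasurableSpace Ω'] {P' : Measure Ω'} [IsProbabilityMeasure P'] {Y : Ω' → ℝ}
    (hY : HasLaw Y (gaussianReal 0 (Real.toNNReal
      ((Scoring.autocov ((κF ∘ₖ K).comap s h.measurable_s) (fwdPathLaw ν₀ κF)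
          (fun ω => Real.exp (-W ω) - ((ν₀ univ)⁻¹ * ν₁ univ).toReal) 0
        + 2 * ∑' t, Scoring.autocov ((κF ∘ₖ K).comap s h.measurable_s) (fwdPathLaw ν₀ κF)
          (fun ω => Real.exp (-W ω) - ((ν₀ univ)⁻¹ * ν₁ univ).toReal) (t + 1))
        / ((ν₀ univ)⁻¹ * ν₁ univ).toReal ^ 2))) P')
    [∀ r, IsProbabilityMeasure (Kernel.trajMeasure (X := fun _ : ℕ => E) (μ r)
        (fun n : ℕ => ((κF ∘ₖ K).comap s h.measurable_s).comap
          (fun hh : (j : ↥(Finset.Iic n)) → E => hh ⟨n, Finset.mem_Iic.2 le_rfl⟩)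
          (measurable_pi_apply _)))] :
    TendstoInDistribution (fun (n : ℕ) (ω : ι → ℕ → E) =>
        Real.sqrt ((Fintype.card ι : ℝ) * n)
          * (-Real.log ((∑ r, ∑ i ∈ range n, Real.exp (-W (ω r i))) / ((Fintype.card ι : ℝ) * n))
            - ΔF))
      atTop Y (fun _ => Measure.pi fun r => Kernel.trajMeasure (X := fun _ : ℕ => E) (μ r)
        (fun n : ℕ => ((κF ∘ₖ K).comap s h.measurable_s).comap
          (fun hh : (j : ↥(Finset.Iic n)) → E => hh ⟨n, Finset.mem_Iic.2 le_rfl⟩)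
          (measurable_pi_apply _))) P' := by
  set θ : ℝ := ((ν₀ univ)⁻¹ * ν₁ univ).toReal with hθdef
  have hθ : 0 < θ := by rw [← hΔF]; exact Real.exp_pos _
  set σ2 : ℝ := Scoring.autocov ((κF ∘ₖ K).comap s h.measurable_s) (fwdPathLaw ν₀ κF)
        (fun ω => Real.exp (-W ω) - θ) 0
      + 2 * ∑' t, Scoring.autocov ((κF ∘ₖ K).comap s h.measurable_s) (fwdPathLaw ν₀ κF)
        (fun ω => Real.exp (-W ω) - θ) (t + 1) with hσ2
  have hwm : Measurable fun ε => Real.exp (-W ε) := Real.measurable_exp.comp h.measurable_W.neg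
  -- the pooled mean weight as a measurable statistic of the replica paths
  set Ybar : ℕ → (ι → ℕ → E) → ℝ := fun n ω =>
    (∑ r, ∑ i ∈ range n, Real.exp (-W (ω r i))) / ((Fintype.card ι : ℝ) * n) with hYbar
  have hYm : ∀ n, Measurable (Ybar n) := fun n =>
    (Finset.measurable_sum _ fun r _ => Finset.measurable_sum _ fun i _ =>
      hwm.comp ((measurable_pi_apply i).comp (measurable_pi_apply r))).div_const _
  -- `Y₀ = −θ·Y` has law `N(0, σ²_w)` (clipping handled as in GEN-22)
  have hY₀ : HasLaw (fun ω' => -θ * Y ω') (gaussianReal 0 σ2.toNNReal) P' := by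
    rcases le_or_gt 0 σ2 with hσ | hσ
    · exact hasLaw_const_mul_gaussianReal hσ hθ.ne' (neg_sq θ) hY
    · have h1 : (σ2 / θ ^ 2).toNNReal = 0 :=
        Real.toNNReal_of_nonpos (div_nonpos_of_nonpos_of_nonneg hσ.le (sq_nonneg _))
      have h2 : σ2.toNNReal = 0 := Real.toNNReal_of_nonpos hσ.le
      rw [h1] at hY
      rw [h2]
      have h3 := gaussianReal_const_mul hY (-θ)
      rw [mul_zero] at h3
      convert h3 using 2
      simp
  -- §2: `√(Rn)(Ȳ_{R,n} − θ) ⇒ Y₀`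
  have clt := h.tendstoInDistribution_sqrt_mul_pooledMeanWeight_sub_restartChains K h0 hK hm0 hmin hB
    μ (P' := P') (Y := fun ω' => -θ * Y ω') hY₀
  have hae := h.tendsto_pooledMeanWeight_ae_restartChains K h0 hK hm0 hmin μ
  -- name the replica law only now (`set` replaces it definitionally in `clt` / `hae`)
  set P := Measure.pi fun r => Kernel.trajMeasure (X := fun _ : ℕ => E) (μ r)
    (fun n : ℕ => ((κF ∘ₖ K).comap s h.measurable_s).comap
      (fun hh : (j : ↥(Finset.Iic n)) → E => hh ⟨n, Finset.mem_Iic.2 le_rfl⟩)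
      (measurable_pi_apply _)) with hP
  -- the slope factor `−dslope log θ Ȳ_{R,n} → −θ⁻¹` almost surely, hence in probability
  have hBm : ∀ n, Measurable fun ω : ι → ℕ → E => -dslope Real.log θ (Ybar n ω) := fun n =>
    ((measurable_dslope_log θ).comp (hYm n)).neg
  have hBconv : TendstoInMeasure P (fun n (ω : ι → ℕ → E) => -dslope Real.log θ (Ybar n ω))
      atTop (fun _ => -θ⁻¹) := by
    refine tendstoInMeasure_of_tendsto_ae (fun n => (hBm n).aestronglyMeasurable) ?_
    filter_upwards [hae] with ω hω
    have hcont : ContinuousAt (dslope Real.log θ) θ :=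
      continuousAt_dslope_same.2 (Real.differentiableAt_log hθ.ne')
    have hval : dslope Real.log θ θ = θ⁻¹ := by rw [dslope_same, Real.deriv_log]
    have hd : Tendsto (fun n : ℕ => dslope Real.log θ (Ybar n ω)) atTop (𝓝 θ⁻¹) := by
      rw [← hval]; exact hcont.tendsto.comp hω
    exact hd.neg
  -- Slutsky: the product converges to `Y₀ · (−θ⁻¹) = Y`
  have hXB := clt.continuous_comp_prodMk_of_tendstoInMeasure_const
    (g := fun p : ℝ × ℝ => p.1 * p.2) (by fun_prop) hBconv (fun n => (hBm n).aemeasurable)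
  -- the two statistics coincide surely: `−log Ȳ − ΔF = −(Ȳ − θ) · dslope log θ Ȳ`; the limit is `Y`
  have hΔF' : ΔF = -Real.log θ := by rw [← hΔF, Real.log_exp, neg_neg]
  refine hXB.congr (fun n => Eventually.of_forall fun ω => ?_) (Eventually.of_forall fun ω' => ?_)
  · have hds := sub_smul_dslope Real.log θ (Ybar n ω)
    rw [smul_eq_mul] at hds
    simp only [hΔF']
    rw [← hθdef,
      show (∑ r, ∑ i ∈ range n, Real.exp (-W (ω r i))) / ((Fintype.card ι : ℝ) * n) = Ybar n ω
        from rfl]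
    linear_combination (-Real.sqrt ((Fintype.card ι : ℝ) * n)) * hds
  · simp only
    field_simp

/-- **THE POOLED JARZYNSKI LANE'S CLT FROM EVERY FAMILY OF LAUNCH CONFIGURATIONS** (the engine's
form): replica `r` first launched from ANY configuration `x r` (`μ r = κF (x r)`), then `K` between
launches, the `R` streams independent — for every real random variable `Y` with law
`N(0, σ²_w / (Z₁/Z₀)²)`, `√(R n) (ΔF̂_{R,n} − ΔF) ⇒ Y`. -/
theorem tendstoInDistribution_sqrt_mul_pooledJarzynski_sub_restartChains_everyStart (K : Kernel Ω Ω)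
    [IsMarkovKernel K] (h0 : ν₀ univ ≠ 0) (hK : Kernel.Invariant K ν₀)
    (h : CrooksPair ν₀ ν₁ κF κR s e W) {ΔF : ℝ}
    (hΔF : Real.exp (-ΔF) = ((ν₀ univ)⁻¹ * ν₁ univ).toReal) {m : Measure Ω} [IsFiniteMeasure m]
    (hm0 : m univ ≠ 0) (hmin : ∀ z, m ≤ K z) {B : ℝ} (hB : ∀ ω, -B ≤ W ω) (x : ι → Ω)
    {Ω' : Type*} [MeasurableSpace Ω'] {P' : Measure Ω'} [IsProbabilityMeasure P'] {Y : Ω' → ℝ}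
    (hY : HasLaw Y (gaussianReal 0 (Real.toNNReal
      ((Scoring.autocov ((κF ∘ₖ K).comap s h.measurable_s) (fwdPathLaw ν₀ κF)
          (fun ω => Real.exp (-W ω) - ((ν₀ univ)⁻¹ * ν₁ univ).toReal) 0
        + 2 * ∑' t, Scoring.autocov ((κF ∘ₖ K).comap s h.measurable_s) (fwdPathLaw ν₀ κF)
          (fun ω => Real.exp (-W ω) - ((ν₀ univ)⁻¹ * ν₁ univ).toReal) (t + 1))
        / ((ν₀ univ)⁻¹ * ν₁ univ).toReal ^ 2))) P')
    [∀ r, IsProbabilityMeasure (Kernel.trajMeasure (X := fun _ : ℕ => E) (κF (x r))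
        (fun n : ℕ => ((κF ∘ₖ K).comap s h.measurable_s).comap
          (fun hh : (j : ↥(Finset.Iic n)) → E => hh ⟨n, Finset.mem_Iic.2 le_rfl⟩)
          (measurable_pi_apply _)))] :
    TendstoInDistribution (fun (n : ℕ) (ω : ι → ℕ → E) =>
        Real.sqrt ((Fintype.card ι : ℝ) * n)
          * (-Real.log ((∑ r, ∑ i ∈ range n, Real.exp (-W (ω r i))) / ((Fintype.card ι : ℝ) * n))
            - ΔF))
      atTop Y (fun _ => Measure.pi fun r => Kernel.trajMeasure (X := fun _ : ℕ => E) (κF (x r))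
        (fun n : ℕ => ((κF ∘ₖ K).comap s h.measurable_s).comap
          (fun hh : (j : ↥(Finset.Iic n)) → E => hh ⟨n, Finset.mem_Iic.2 le_rfl⟩)
          (measurable_pi_apply _))) P' :=
  h.tendstoInDistribution_sqrt_mul_pooledJarzynski_sub_restartChains K h0 hK hΔF hm0 hmin hB
    (fun r => κF (x r)) hY

end CrooksPair

end Summit.Ventures.LatticeQCDFlow.Exactness.GeneralNCMC
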